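import Mathlib.Analysis.InnerProductSpace.Dual
import Literature.Analysis.Calculus.IntervalCauchySchwarz
import Literature.Analysis.Calculus.RadialCutoff
import Literature.MathematicalPhysics.QuantumLattice.YangMillsHeatFlowWeightedEnergy
import HarnessLib

/-!
# Local energy comparison for the Yang–Mills heat flow (Waldron 2019, §3, (3.3), Lemmas 3.2(a), 3.3(a))

Step three of the printed proof of Waldron's Theorem 1.1 (A. Waldron, *Long-time existence for
Yang–Mills flow*, Invent. math. 217 (2019), §3), on which the named fact
`Literature.MathematicalPhysics.QuantumLattice.Waldron2019_yangMillsFlow_flatTorus` rests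
(`Waldron2019_yangMillsFlow_flatTorus_of_thm11`), in the flat setting of the named fact
(connections on a finite-dimensional real inner product space `E`, coefficients `M_m(ℂ)` with the
Hilbert–Schmidt inner product, `𝔲(m)`-valued jointly smooth solutions of `∂ₜA = div_A F = −D^*F`
on an open time set `𝒯`). Notation: `e = ∑_{i<j}‖F_{ij}‖²` (`|F|²`), `(div F)_j = divCurvature`
(`= −(D^*F)_j`), `|D^*F|² = ∑ⱼ‖(div F)_j‖²`, `Wᵢ = ∑ⱼ ⟨F_{ij}, (div F)_j⟩` (the energy flux, minus
Waldron's `⟨D^*F^j, F_{ij}⟩`), `B_ρ = B_ρ(x₀)`, `U_λ^ρ = B̄_ρ ∖ B_λ`.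

* `sum_sq_apply_orthonormalBasis_eq`, `abs_sum_sum_inner_mul_le` — the pointwise bound
  `|∑ᵢ Wᵢ ∂ᵢφ| ≤ ‖Dφ‖ √(2e) |D^*F|` ("Hölder's inequality on the last term");
* `intervalIntegral_setIntegral_sqrt_mul_sqrt_le` — Cauchy–Schwarz in space-time,
  `∫∫_V √f √g ≤ √(∫∫_V f) √(∫∫_V g)`;
* `integral_mul_divergenceTerm_eq_neg_integral_flux`, `weightedEnergy_sub_eq_flux_of_flow_on`
  — **(3.3)** integrated in time for a `C¹` compactly supported weight:
  `∫ φ e(τ) − ∫ φ e(t) = −2∫_t^τ∫ φ |D^*F|² − 2∫_t^τ∫ ∑ᵢ Wᵢ ∂ᵢφ`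
  (`½ d/dt ∫|F|²φ + ∫|D^*F|²φ + ∫⟨D^*F^i, F_{ij}∇^jφ⟩ = 0`);
* `abs_weightedEnergy_sub_le_of_flow_on` — the **local energy comparison** behind Lemmas 3.2(a)
  and 3.3(a): for a `C¹` cut-off `0 ≤ φ ≤ 1` vanishing off a bounded set `V` with `‖Dφ‖ ≤ K`,
  `sup_{[t₀,τ]} ∫_V e ≤ E` and `∫_{t₀}^τ∫_V |D^*F|² ≤ δ²`,
  `|∫ φ e(τ) − ∫ φ e(t)| ≤ 2δ(δ + √2 K √((τ − t₀)E))` for `t ∈ [t₀, τ]`;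
* `Waldron2019_lemma_3_2a` — **Lemma 3.2(a)**: `‖F(τ)‖²_{L²(B_{R/2})} ≤ ‖F(t)‖²_{L²(B_R)} + γ` and
  `‖F(t)‖²_{L²(B_{R/2})} ≤ ‖F(τ)‖²_{L²(B_R)} + γ` with `γ = 2δ(δ + c√((τ−t₀)E)/R)`;
* `Waldron2019_lemma_3_3a` — **Lemma 3.3(a)**: the same for the annuli `U₁ = U_{αR}^R`,
  `U₂ = U_{α²R}^{R/α}`, `½ ≤ α < 1`, with `γ = 2δ(δ + c√((τ−t₀)E)/((1−α)R))`.
  (Waldron's `γ = 2δ(δ + 4√(τE)/R)` uses the cut-off gradient `4/R`; here `c` is an absolute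
  constant coming from the cut-offs of `Literature.Analysis.Calculus.RadialCutoff`, and the base
  time `t₀` replaces his `0`.)

References: A. Waldron, *Long-time existence for Yang–Mills flow*, Invent. math. 217 (2019),
1069–1147, §3, (3.3), Lemma 3.2, Lemma 3.3 [Waldron2019].
-/

noncomputable section

open scoped ContDiff Topology RealInnerProductSpace Matrix
open Set Filter MeasureTheory Metric

namespace Literature.MathematicalPhysics.QuantumLattice

/-! ### Pointwise Cauchy–Schwarz bounds -/

section PointwiseCS

variable {E : Type*} [NormedAddCommGroup E] [InnerProductSpace ℝ E] [FiniteDimensional ℝ E]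
variable {ι : Type*} [Fintype ι]

/-- **Parseval for a functional**: `∑ᵢ (L bᵢ)² = ‖L‖²` for a continuous linear functional `L`
and an orthonormal basis `b` (Riesz representation). [folklore] -/
theorem sum_sq_apply_orthonormalBasis_eq (b : OrthonormalBasis ι ℝ E) (L : E →L[ℝ] ℝ) :
    ∑ i, (L (b i)) ^ 2 = ‖L‖ ^ 2 := by
  set v : E := (InnerProductSpace.toDual ℝ E).symm L with hv
  have hL : ∀ w, L w = ⟪v, w⟫ := fun w => (InnerProductSpace.toDual_symm_apply).symm
  simp_rw [hL]
  rw [b.sum_sq_inner_left v, hv, LinearIsometryEquiv.norm_map]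

variable {V : Type*} [NormedAddCommGroup V] [InnerProductSpace ℝ V]

omit [FiniteDimensional ℝ E] in
/-- **The flux is bounded by `‖a‖ √(∑‖F‖²) √(∑‖D‖²)`**: for families `F_{ij}`, `D_j` in a real
inner product space and real coefficients `aᵢ`,
`|∑ᵢ (∑ⱼ ⟨F_{ij}, D_j⟩) aᵢ| ≤ √(∑ᵢ aᵢ²) √(∑ᵢⱼ ‖F_{ij}‖²) √(∑ⱼ ‖D_j‖²)` (Cauchy–Schwarz twice).
[folklore] -/
theorem abs_sum_sum_inner_mul_le (F : ι → ι → V) (D : ι → V) (a : ι → ℝ) :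
    |∑ i, (∑ j, ⟪F i j, D j⟫) * a i| ≤
      Real.sqrt (∑ i, a i ^ 2) * Real.sqrt (∑ i, ∑ j, ‖F i j‖ ^ 2) *
        Real.sqrt (∑ j, ‖D j‖ ^ 2) := by
  -- regroup: `∑ᵢ (∑ⱼ ⟨F_{ij}, D_j⟩) aᵢ = ∑ⱼ ⟨∑ᵢ aᵢ F_{ij}, D_j⟩`
  have hre : ∑ i, (∑ j, ⟪F i j, D j⟫) * a i = ∑ j, ⟪∑ i, a i • F i j, D j⟫ := by
    simp_rw [Finset.sum_mul, sum_inner, real_inner_smul_left]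
    rw [Finset.sum_comm]
    exact Finset.sum_congr rfl fun i _ => Finset.sum_congr rfl fun j _ => by ring
  rw [hre]
  -- Cauchy–Schwarz in `j`
  have h1 : |∑ j, ⟪∑ i, a i • F i j, D j⟫| ≤
      Real.sqrt (∑ j, ‖∑ i, a i • F i j‖ ^ 2) * Real.sqrt (∑ j, ‖D j‖ ^ 2) := by
    refine (Finset.abs_sum_le_sum_abs _ _).trans ?_
    refine (Finset.sum_le_sum fun j _ => abs_real_inner_le_norm (∑ i, a i • F i j) (D j)).trans ?_
    exact Real.sum_mul_le_sqrt_mul_sqrt _ _ _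
  -- Cauchy–Schwarz in `i` inside the norm
  have h2 : ∀ j, ‖∑ i, a i • F i j‖ ^ 2 ≤ (∑ i, a i ^ 2) * ∑ i, ‖F i j‖ ^ 2 := by
    intro j
    have hn : ‖∑ i, a i • F i j‖ ≤ ∑ i, |a i| * ‖F i j‖ :=
      (norm_sum_le _ _).trans (Finset.sum_le_sum fun i _ => by rw [norm_smul, Real.norm_eq_abs])
    have hcs : ∑ i, |a i| * ‖F i j‖ ≤ Real.sqrt (∑ i, |a i| ^ 2) * Real.sqrt (∑ i, ‖F i j‖ ^ 2) :=
      Real.sum_mul_le_sqrt_mul_sqrt _ _ _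
    simp_rw [sq_abs] at hcs
    have h0 : 0 ≤ ∑ i, |a i| * ‖F i j‖ := Finset.sum_nonneg fun i _ => by positivity
    calc ‖∑ i, a i • F i j‖ ^ 2 ≤ (∑ i, |a i| * ‖F i j‖) ^ 2 :=
          pow_le_pow_left₀ (norm_nonneg _) hn 2
      _ ≤ (Real.sqrt (∑ i, a i ^ 2) * Real.sqrt (∑ i, ‖F i j‖ ^ 2)) ^ 2 :=
          pow_le_pow_left₀ h0 hcs 2
      _ = (∑ i, a i ^ 2) * ∑ i, ‖F i j‖ ^ 2 := by
          rw [mul_pow, Real.sq_sqrt (Finset.sum_nonneg fun i _ => by positivity),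
            Real.sq_sqrt (Finset.sum_nonneg fun i _ => by positivity)]
  have h3 : ∑ j, ‖∑ i, a i • F i j‖ ^ 2 ≤ (∑ i, a i ^ 2) * ∑ i, ∑ j, ‖F i j‖ ^ 2 := by
    calc ∑ j, ‖∑ i, a i • F i j‖ ^ 2 ≤ ∑ j, (∑ i, a i ^ 2) * ∑ i, ‖F i j‖ ^ 2 :=
          Finset.sum_le_sum fun j _ => h2 j
      _ = (∑ i, a i ^ 2) * ∑ i, ∑ j, ‖F i j‖ ^ 2 := by
          rw [← Finset.mul_sum, Finset.sum_comm]
  calc |∑ j, ⟪∑ i, a i • F i j, D j⟫|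
      ≤ Real.sqrt (∑ j, ‖∑ i, a i • F i j‖ ^ 2) * Real.sqrt (∑ j, ‖D j‖ ^ 2) := h1
    _ ≤ Real.sqrt ((∑ i, a i ^ 2) * ∑ i, ∑ j, ‖F i j‖ ^ 2) * Real.sqrt (∑ j, ‖D j‖ ^ 2) := by
        gcongr
    _ = Real.sqrt (∑ i, a i ^ 2) * Real.sqrt (∑ i, ∑ j, ‖F i j‖ ^ 2) *
          Real.sqrt (∑ j, ‖D j‖ ^ 2) := by
        rw [Real.sqrt_mul (Finset.sum_nonneg fun i _ => by positivity)]

end PointwiseCS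

/-! ### Cauchy–Schwarz in space-time -/

section SpaceTimeCS

variable {E : Type*} [NormedAddCommGroup E] [InnerProductSpace ℝ E] [FiniteDimensional ℝ E]
  [MeasurableSpace E] [BorelSpace E]

/-- **Cauchy–Schwarz in space-time.** For nonnegative slab-continuous `f, g`, a bounded
measurable `V` and `[t₁, t₂] ⊆ 𝒯`:
`∫_{t₁}^{t₂}∫_V √f √g ≤ √(∫_{t₁}^{t₂}∫_V f) √(∫_{t₁}^{t₂}∫_V g)` (via `2√f√g ≤ λf + g/λ` and
optimisation in `λ`). [folklore] -/
theorem intervalIntegral_setIntegral_sqrt_mul_sqrt_le {𝒯 : Set ℝ} {f g : ℝ × E → ℝ}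
    {K V : Set E} (hK : IsCompact K) (hVK : V ⊆ K) (hV : MeasurableSet V)
    (hf : ContinuousOn f (𝒯 ×ˢ (univ : Set E))) (hg : ContinuousOn g (𝒯 ×ˢ (univ : Set E)))
    (hf0 : ∀ p, 0 ≤ f p) (hg0 : ∀ p, 0 ≤ g p) {t₁ t₂ : ℝ} (h12 : t₁ ≤ t₂)
    (hsub : Icc t₁ t₂ ⊆ 𝒯) :
    ∫ s in t₁..t₂, ∫ y in V, Real.sqrt (f (s, y)) * Real.sqrt (g (s, y)) ≤
      Real.sqrt (∫ s in t₁..t₂, ∫ y in V, f (s, y)) *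
        Real.sqrt (∫ s in t₁..t₂, ∫ y in V, g (s, y)) := by
  have hfg : ContinuousOn (fun p : ℝ × E => Real.sqrt (f p) * Real.sqrt (g p)) (𝒯 ×ˢ univ) :=
    (Real.continuous_sqrt.comp_continuousOn hf).mul (Real.continuous_sqrt.comp_continuousOn hg)
  have hIf : 0 ≤ ∫ s in t₁..t₂, ∫ y in V, f (s, y) :=
    intervalIntegral.integral_nonneg h12 fun s _ => setIntegral_nonneg hV fun y _ => hf0 _
  have hIg : 0 ≤ ∫ s in t₁..t₂, ∫ y in V, g (s, y) :=
    intervalIntegral.integral_nonneg h12 fun s _ => setIntegral_nonneg hV fun y _ => hg0 _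
  refine Literature.Analysis.Calculus.le_sqrt_mul_sqrt_of_forall_pos hIf hIg fun lam hlam => ?_
  -- `2 √f √g ≤ λ f + g/λ` pointwise, then integrate
  have hpt : ∀ p, 2 * (Real.sqrt (f p) * Real.sqrt (g p)) ≤ lam * f p + g p / lam := by
    intro p
    have h := two_mul_le_add_sq (Real.sqrt lam * Real.sqrt (f p)) (Real.sqrt (g p) / Real.sqrt lam)
    have hl : Real.sqrt lam ≠ 0 := (Real.sqrt_pos.mpr hlam).ne'
    calc 2 * (Real.sqrt (f p) * Real.sqrt (g p))
        = 2 * (Real.sqrt lam * Real.sqrt (f p)) * (Real.sqrt (g p) / Real.sqrt lam) := by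
          field_simp
      _ ≤ (Real.sqrt lam * Real.sqrt (f p)) ^ 2 + (Real.sqrt (g p) / Real.sqrt lam) ^ 2 := h
      _ = lam * f p + g p / lam := by
          rw [mul_pow, div_pow, Real.sq_sqrt hlam.le, Real.sq_sqrt (hf0 p), Real.sq_sqrt (hg0 p)]
  -- integrability in time of the three spatial integrals
  have hi_fg := intervalIntegrable_setIntegral_of_continuousOn hK hVK hfg h12 hsub
  have hi_f := intervalIntegrable_setIntegral_of_continuousOn hK hVK hf h12 hsub
  have hi_g := intervalIntegrable_setIntegral_of_continuousOn hK hVK hg h12 hsub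
  -- the bound at each time
  have hslice : ∀ s ∈ Icc t₁ t₂, 2 * ∫ y in V, Real.sqrt (f (s, y)) * Real.sqrt (g (s, y)) ≤
      lam * (∫ y in V, f (s, y)) + (∫ y in V, g (s, y)) / lam := by
    intro s hs
    have hs𝒯 : s ∈ 𝒯 := hsub hs
    have hfs : Continuous fun y => f (s, y) := continuous_slice_of_continuousOn_slab hf hs𝒯
    have hgs : Continuous fun y => g (s, y) := continuous_slice_of_continuousOn_slab hg hs𝒯
    have hIV : ∀ {h : E → ℝ}, Continuous h → IntegrableOn h V := fun hh =>
      (hh.continuousOn.integrableOn_compact hK).mono_set hVK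
    have hif : IntegrableOn (fun y => f (s, y)) V := hIV hfs
    have hig : IntegrableOn (fun y => g (s, y)) V := hIV hgs
    rw [← integral_const_mul, ← integral_const_mul, ← integral_div, ← integral_add (hif.const_mul lam)
      (hig.div_const lam)]
    exact setIntegral_mono_on ((hIV ((Real.continuous_sqrt.comp hfs).mul
      (Real.continuous_sqrt.comp hgs))).const_mul 2) ((hif.const_mul lam).add (hig.div_const lam))
      hV fun y _ => hpt (s, y)
  calc 2 * ∫ s in t₁..t₂, ∫ y in V, Real.sqrt (f (s, y)) * Real.sqrt (g (s, y))
      = ∫ s in t₁..t₂, 2 * ∫ y in V, Real.sqrt (f (s, y)) * Real.sqrt (g (s, y)) :=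
        (intervalIntegral.integral_const_mul _ _).symm
    _ ≤ ∫ s in t₁..t₂, (lam * (∫ y in V, f (s, y)) + (∫ y in V, g (s, y)) / lam) :=
        intervalIntegral.integral_mono_on h12 (hi_fg.const_mul 2)
          ((hi_f.const_mul lam).add (hi_g.div_const lam)) hslice
    _ = lam * (∫ s in t₁..t₂, ∫ y in V, f (s, y)) + (∫ s in t₁..t₂, ∫ y in V, g (s, y)) / lam := by
        rw [intervalIntegral.integral_add (hi_f.const_mul lam) (hi_g.div_const lam),
          intervalIntegral.integral_const_mul, intervalIntegral.integral_div]

end SpaceTimeCS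

/-! ### The first-order weighted identity (3.3) -/

section FluxIdentity

open scoped Matrix.Norms.Frobenius

attribute [local instance] frobeniusInnerProductSpace

variable {m : Type*} [Fintype m] [DecidableEq m]
variable {E : Type*} [NormedAddCommGroup E] [InnerProductSpace ℝ E] [FiniteDimensional ℝ E]
  [MeasurableSpace E] [BorelSpace E]
variable {ι : Type*} [Fintype ι] [LinearOrder ι]

omit [LinearOrder ι] in
/-- **One integration by parts** (Waldron 2019, (3.3)). For a smooth `𝔲(m)`-valued connection
`B` and a `C¹` compactly supported weight `φ`,
`∫ φ ∑ᵢⱼ ∂ᵢ⟨F_{ij}, (div F)_j⟩ = −∫ ∑ᵢ (∑ⱼ ⟨F_{ij}, (div F)_j⟩) ∂ᵢφ`. [cite: Waldron2019, §3 (3.3)] -/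
theorem integral_mul_divergenceTerm_eq_neg_integral_flux (b : OrthonormalBasis ι ℝ E)
    {B : Connection E (Matrix m m ℂ)} (hB : ContDiff ℝ ∞ B)
    {φ : E → ℝ} (hφ : ContDiff ℝ 1 φ) (hφc : HasCompactSupport φ) :
    ∫ y, φ y * ∑ i, ∑ j, fderiv ℝ (fun z => ⟪curvature B z (b i) (b j),
        divCurvature B z (b j)⟫) y (b i) =
      -∫ y, ∑ i, (∑ j, ⟪curvature B y (b i) (b j), divCurvature B y (b j)⟫) *
        fderiv ℝ φ y (b i) := by
  have hB3 : ContDiff ℝ 3 B := hB.of_le ENat.LEInfty.out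
  have hB21 : ContDiff ℝ (2 + 1) B := by rw [show (2 : WithTop ℕ∞) + 1 = 3 by norm_num]; exact hB3
  have hB12 : ContDiff ℝ (1 + 2) B := by rw [show (1 : WithTop ℕ∞) + 2 = 3 by norm_num]; exact hB3
  set W : ι → E → ℝ := fun i y => ∑ j, ⟪curvature B y (b i) (b j), divCurvature B y (b j)⟫
    with hW
  have hF : ∀ i j, ContDiff ℝ 2 fun y => curvature B y (b i) (b j) := fun i j =>
    contDiff_curvature_apply hB21 (b i) (b j)
  have hD : ∀ j, ContDiff ℝ 1 fun y => divCurvature B y (b j) := fun j =>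
    contDiff_divCurvature_apply hB12 (b j)
  have hterm : ∀ i j, ContDiff ℝ 1 fun y => ⟪curvature B y (b i) (b j), divCurvature B y (b j)⟫ :=
    fun i j => ((hF i j).of_le (by norm_num)).inner ℝ (hD j)
  have hWs : ∀ i, ContDiff ℝ 1 (W i) := fun i => ContDiff.sum fun j _ => hterm i j
  have hdiv : ∀ y, ∑ i, ∑ j, fderiv ℝ (fun z => ⟪curvature B z (b i) (b j),
      divCurvature B z (b j)⟫) y (b i) = ∑ i, fderiv ℝ (W i) y (b i) := by
    intro y
    refine Finset.sum_congr rfl fun i _ => ?_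
    rw [hW, fderiv_fun_sum fun j _ => ((hterm i j).differentiable one_ne_zero) y,
      FunLike.coe_sum, Finset.sum_apply]
  simp_rw [hdiv]
  exact integral_mul_sum_fderiv_eq_neg_integral (fun i => b i) hφ hφc hWs

omit [MeasurableSpace E] [BorelSpace E] [LinearOrder ι] in
/-- **Joint continuity of the flux integrand.** Along a jointly smooth solution of the flow, the
integrand `∑ᵢ (∑ⱼ ⟨F_{ij}, (div F)_j⟩) ∂ᵢφ` of (3.3) is jointly continuous on the slab (`div F = Ȧ`
is read off the joint derivative). [folklore] -/
theorem continuousOn_flux_of_flow_on (b : OrthonormalBasis ι ℝ E)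
    {A : ℝ → Connection E (Matrix m m ℂ)} {𝒯 : Set ℝ} (h𝒯 : IsOpen 𝒯)
    (hA : ContDiffOn ℝ ∞ (fun p : ℝ × E => A p.1 p.2) (𝒯 ×ˢ (univ : Set E)))
    (hpde : ∀ ⦃s : ℝ⦄, s ∈ 𝒯 → ∀ y w, deriv (fun s' => A s' y w) s = divCurvature (A s) y w)
    {φ : E → ℝ} (hφ : ContDiff ℝ 1 φ) :
    ContinuousOn (fun p : ℝ × E => ∑ i, (∑ j, ⟪curvature (A p.1) p.2 (b i) (b j),
        divCurvature (A p.1) p.2 (b j)⟫) * fderiv ℝ φ p.2 (b i)) (𝒯 ×ˢ (univ : Set E)) := by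
  have hU : IsOpen (𝒯 ×ˢ (univ : Set E)) := h𝒯.prod isOpen_univ
  have h1 := hA.continuousOn_fderiv_of_isOpen hU ENat.LEInfty.out
  have hF : ∀ i j, ContinuousOn (fun p : ℝ × E => curvature (A p.1) p.2 (b i) (b j))
      (𝒯 ×ˢ (univ : Set E)) := fun i j =>
    (contDiffOn_curvature_joint (m := 0) hU hA (by rw [zero_add]; exact ENat.LEInfty.out)
      (b i) (b j)).continuousOn
  have hG : ∀ j, ContinuousOn (fun p : ℝ × E =>
      fderiv ℝ (fun q : ℝ × E => A q.1 q.2) p ((1 : ℝ), (0 : E)) (b j)) (𝒯 ×ˢ (univ : Set E)) :=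
    fun j => (h1.clm_apply continuousOn_const).clm_apply continuousOn_const
  have hdφ : ∀ i, Continuous fun y => fderiv ℝ φ y (b i) := fun i =>
    (hφ.continuous_fderiv one_ne_zero).clm_apply continuous_const
  have hc : ContinuousOn (fun p : ℝ × E => ∑ i, (∑ j, ⟪curvature (A p.1) p.2 (b i) (b j),
      fderiv ℝ (fun q : ℝ × E => A q.1 q.2) p ((1 : ℝ), (0 : E)) (b j)⟫) *
        fderiv ℝ φ p.2 (b i)) (𝒯 ×ˢ (univ : Set E)) := by
    refine continuousOn_finsetSum _ fun i _ => ?_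
    exact (continuousOn_finsetSum _ fun j _ => (hF i j).inner (hG j)).mul
      ((hdφ i).comp_continuousOn continuousOn_snd)
  refine hc.congr ?_
  rintro ⟨s, y⟩ hp
  simp only
  refine Finset.sum_congr rfl fun i _ => ?_
  congr 1
  refine Finset.sum_congr rfl fun j _ => ?_
  rw [norm_divCurvature_eq_of_flow_on h𝒯 hA (by simp) hp.1 y (b j) (hpde hp.1 y (b j))]

/-- **Waldron's local energy identity (3.3), integrated in time.** Let `A` be jointly smooth on
`𝒯 × E` (`𝒯` open), `𝔲(m)`-valued, solving `∂ₜA = div_A F = −D^*F` on `𝒯`; let `φ` be a `C¹`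
compactly supported weight and `[t₁, t₂] ⊆ 𝒯`. Then, with `e = ∑_{i<j}‖F_{ij}‖²` and
`Wᵢ = ∑ⱼ ⟨F_{ij}, (div F)_j⟩`,
`∫ φ e(t₂) − ∫ φ e(t₁) = −2∫_{t₁}^{t₂}∫ φ ∑ⱼ‖(div F)_j‖² − 2∫_{t₁}^{t₂}∫ ∑ᵢ Wᵢ ∂ᵢφ`, i.e.
`½ d/dt ∫ |F|²φ + ∫ |D^*F|²φ + ∫ ⟨D^*F^i, F_{ij}∇^jφ⟩ = 0` ("integrating by parts once in
(2.4)"). [cite: Waldron2019, §3 (3.3)] -/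
theorem weightedEnergy_sub_eq_flux_of_flow_on (b : OrthonormalBasis ι ℝ E)
    {A : ℝ → Connection E (Matrix m m ℂ)} {𝒯 : Set ℝ} (h𝒯 : IsOpen 𝒯)
    (hA : ContDiffOn ℝ ∞ (fun p : ℝ × E => A p.1 p.2) (𝒯 ×ˢ (univ : Set E)))
    (hval : ∀ ⦃s : ℝ⦄, s ∈ 𝒯 → (A s).IsValuedIn (skewAdjoint.submodule ℝ (Matrix m m ℂ)))
    (hpde : ∀ ⦃s : ℝ⦄, s ∈ 𝒯 → ∀ y w, deriv (fun s' => A s' y w) s = divCurvature (A s) y w)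
    {φ : E → ℝ} (hφ : ContDiff ℝ 1 φ) (hφc : HasCompactSupport φ)
    {t₁ t₂ : ℝ} (h12 : t₁ ≤ t₂) (hsub : Icc t₁ t₂ ⊆ 𝒯) :
    (∫ y, φ y * ymDensityOfBasis b (A t₂) y) - (∫ y, φ y * ymDensityOfBasis b (A t₁) y) =
      -2 * (∫ s in t₁..t₂, ∫ y, φ y * ∑ j, ‖divCurvature (A s) y (b j)‖ ^ 2) -
        2 * ∫ s in t₁..t₂, ∫ y, ∑ i, (∑ j, ⟪curvature (A s) y (b i) (b j),
          divCurvature (A s) y (b j)⟫) * fderiv ℝ φ y (b i) := by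
  set U : Set (ℝ × E) := 𝒯 ×ˢ univ with hU'
  have hU : IsOpen U := h𝒯.prod isOpen_univ
  have h2 : (2 : WithTop ℕ∞) ≤ ∞ := ENat.LEInfty.out
  set K : Set E := tsupport φ with hK
  have hKc : IsCompact K := hφc
  -- the densities on space-time
  set e : ℝ × E → ℝ := fun p => ymDensityOfBasis b (A p.1) p.2 with he
  set Pt : ℝ × E → ℝ := fun p => ∑ i, ∑ j,
    fderiv ℝ (fun y => ⟪curvature (A p.1) y (b i) (b j),
      fderiv ℝ (fun q : ℝ × E => A q.1 q.2) (p.1, y) ((1 : ℝ), (0 : E)) (b j)⟫) p.2 (b i) with hPt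
  set Dis : ℝ × E → ℝ := fun p => ∑ j, ‖divCurvature (A p.1) p.2 (b j)‖ ^ 2 with hDis
  set rate : ℝ × E → ℝ := fun p => 2 * Pt p - 2 * Dis p with hrate
  set Fl : ℝ × E → ℝ := fun p => ∑ i, (∑ j, ⟪curvature (A p.1) p.2 (b i) (b j),
    divCurvature (A p.1) p.2 (b j)⟫) * fderiv ℝ φ p.2 (b i) with hFl
  -- continuity on the slab
  have hrate_c : ContinuousOn rate U := continuousOn_energyRate_of_flow_on b h𝒯 hA h2 hval hpde
  have hPt_c : ContinuousOn Pt U := continuousOn_divergenceTerm_of_flow_on b h𝒯 hA h2 hval hpde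
  have hDis_c : ContinuousOn Dis U := continuousOn_dissipation_of_flow_on b h𝒯 hA hpde
  have he_c : ContinuousOn e U := (contDiffOn_ymDensityOfBasis_joint_on b h𝒯 hA h2).continuousOn
  have hFl_c : ContinuousOn Fl U := continuousOn_flux_of_flow_on b h𝒯 hA hpde hφ
  have hφ_c : Continuous φ := hφ.continuous
  -- the time derivative of `e`
  have hderiv : ∀ p ∈ U, HasDerivAt (fun s => e (s, p.2)) (rate p) p.1 := by
    rintro ⟨s, y⟩ hp
    exact hasDerivAt_ymDensityOfBasis_of_flow_on b h𝒯 hA h2 hp.1 y (hval hp.1 y) (hpde hp.1 y)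
  have hslice_s : ∀ {f : ℝ × E → ℝ}, ContinuousOn f U → ∀ y,
      ContinuousOn (fun s => f (s, y)) (Icc t₁ t₂) := fun hf y =>
    hf.comp (continuous_id.prodMk continuous_const).continuousOn
      fun s hs => ⟨hsub hs, mem_univ y⟩
  -- vanishing off the support of `φ`
  have hφ0 : ∀ y ∉ K, φ y = 0 := fun y hy => image_eq_zero_of_notMem_tsupport hy
  have hFl0 : ∀ s, ∀ y ∉ K, Fl (s, y) = 0 := by
    intro s y hy
    simp only [hFl]
    refine Finset.sum_eq_zero fun i _ => ?_
    rw [fderiv_eq_zero_of_notMem_tsupport hy, zero_apply, mul_zero]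
  -- Step 1: fundamental theorem of calculus in time, pointwise in `y`
  have hFTC : ∀ y, ∫ s in t₁..t₂, rate (s, y) = e (t₂, y) - e (t₁, y) := by
    intro y
    refine intervalIntegral.integral_eq_sub_of_hasDerivAt (f := fun s => e (s, y))
      (f' := fun s => rate (s, y)) (fun s hs => ?_)
      ((hslice_s hrate_c y).intervalIntegrable_of_Icc h12)
    rw [uIcc_of_le h12] at hs
    exact hderiv (s, y) ⟨hsub hs, mem_univ y⟩
  -- Step 2: integrate against `φ`
  have hint_e : ∀ {s : ℝ}, s ∈ 𝒯 → Integrable (fun y => φ y * e (s, y)) := fun hs =>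
    (hφ_c.mul (continuous_slice_of_continuousOn_slab he_c hs)).integrable_of_hasCompactSupport
      hφc.mul_right
  have hLHS : (∫ y, φ y * e (t₂, y)) - ∫ y, φ y * e (t₁, y) =
      ∫ y, ∫ s in t₁..t₂, φ y * rate (s, y) := by
    rw [← integral_sub (hint_e (hsub ⟨h12, le_rfl⟩)) (hint_e (hsub ⟨le_rfl, h12⟩))]
    refine integral_congr_ae (ae_of_all _ fun y => ?_)
    show φ y * e (t₂, y) - φ y * e (t₁, y) = ∫ s in t₁..t₂, φ y * rate (s, y)
    rw [intervalIntegral.integral_const_mul, hFTC y]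
    ring
  -- Step 3: Fubini
  have hχrate_c : ContinuousOn (fun p : ℝ × E => φ p.2 * rate p) U :=
    (hφ_c.comp_continuousOn continuousOn_snd).mul hrate_c
  have hχDis_c : ContinuousOn (fun p : ℝ × E => φ p.2 * Dis p) U :=
    (hφ_c.comp_continuousOn continuousOn_snd).mul hDis_c
  have hswap : ∫ y, ∫ s in t₁..t₂, φ y * rate (s, y) = ∫ s in t₁..t₂, ∫ y, φ y * rate (s, y) := by
    simp_rw [intervalIntegral.integral_of_le h12]
    exact integral_integral_swap (integrable_prod_Ioc_of_continuousOn_of_eq_zero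
      (g := fun p => φ p.2 * rate p) hKc hχrate_c (fun s y hy => by simp only [hφ0 y hy, zero_mul])
      hsub)
  -- Step 4: the identity at each fixed time
  have hinner : ∀ s ∈ Ioc t₁ t₂, ∫ y, φ y * rate (s, y) =
      -2 * (∫ y, Fl (s, y)) - 2 * ∫ y, φ y * Dis (s, y) := by
    intro s hs
    have hs0 : s ∈ 𝒯 := hsub ⟨hs.1.le, hs.2⟩
    have hsm : ContDiff ℝ ∞ (A s) := contDiff_slice_of_contDiffOn_prod hA hs0
    have hAdot : ∀ y w, fderiv ℝ (fun q : ℝ × E => A q.1 q.2) (s, y) ((1 : ℝ), (0 : E)) w =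
        divCurvature (A s) y w := fun y w =>
      (norm_divCurvature_eq_of_flow_on h𝒯 hA (by simp) hs0 y w (hpde hs0 y w)).symm
    have hPt_eq : ∀ y, Pt (s, y) = ∑ i, ∑ j, fderiv ℝ (fun z => ⟪curvature (A s) z (b i) (b j),
        divCurvature (A s) z (b j)⟫) y (b i) := by
      intro y
      simp only [hPt]
      refine Finset.sum_congr rfl fun i _ => Finset.sum_congr rfl fun j _ => ?_
      have hfun : (fun z => ⟪curvature (A s) z (b i) (b j),
          fderiv ℝ (fun q : ℝ × E => A q.1 q.2) (s, z) ((1 : ℝ), (0 : E)) (b j)⟫) =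
          fun z => ⟪curvature (A s) z (b i) (b j), divCurvature (A s) z (b j)⟫ := by
        funext z
        rw [hAdot z (b j)]
      rw [hfun]
    have hdivInt : ∫ y, φ y * Pt (s, y) = -∫ y, Fl (s, y) := by
      simp_rw [hPt_eq]
      exact integral_mul_divergenceTerm_eq_neg_integral_flux b hsm hφ hφc
    have hiP : Integrable (fun y => φ y * Pt (s, y)) :=
      (hφ_c.mul (continuous_slice_of_continuousOn_slab hPt_c hs0)).integrable_of_hasCompactSupport
        hφc.mul_right
    have hiD : Integrable (fun y => φ y * Dis (s, y)) :=
      (hφ_c.mul (continuous_slice_of_continuousOn_slab hDis_c hs0)).integrable_of_hasCompactSupport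
        hφc.mul_right
    calc ∫ y, φ y * rate (s, y) = ∫ y, (2 * (φ y * Pt (s, y)) - 2 * (φ y * Dis (s, y))) := by
          refine integral_congr_ae (ae_of_all _ fun y => ?_)
          simp only [hrate]
          ring
      _ = 2 * (∫ y, φ y * Pt (s, y)) - 2 * ∫ y, φ y * Dis (s, y) := by
          rw [integral_sub (hiP.const_mul 2) (hiD.const_mul 2), integral_const_mul,
            integral_const_mul]
      _ = -2 * (∫ y, Fl (s, y)) - 2 * ∫ y, φ y * Dis (s, y) := by rw [hdivInt]; ring
  -- integrability in time of the two spatial integrals (Fubini)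
  have hFl_t : IntervalIntegrable (fun s => ∫ y, Fl (s, y)) volume t₁ t₂ :=
    intervalIntegrable_integral_of_continuousOn hKc hFl_c hFl0 h12 hsub
  have hDis_t : IntervalIntegrable (fun s => ∫ y, φ y * Dis (s, y)) volume t₁ t₂ :=
    intervalIntegrable_integral_of_continuousOn (g := fun p => φ p.2 * Dis p) hKc hχDis_c
      (fun s y hy => by simp only [hφ0 y hy, zero_mul]) h12 hsub
  have hRHS : ∫ s in t₁..t₂, ∫ y, φ y * rate (s, y) =
      -2 * (∫ s in t₁..t₂, ∫ y, Fl (s, y)) - 2 * ∫ s in t₁..t₂, ∫ y, φ y * Dis (s, y) := by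
    rw [← intervalIntegral.integral_const_mul, ← intervalIntegral.integral_const_mul,
      ← intervalIntegral.integral_sub (hFl_t.const_mul (-2)) (hDis_t.const_mul 2),
      intervalIntegral.integral_of_le h12, intervalIntegral.integral_of_le h12]
    exact setIntegral_congr_fun measurableSet_Ioc hinner
  -- assemble
  rw [hLHS, hswap, hRHS]
  ring

end FluxIdentity

/-! ### The local energy comparison -/

section LocalComparison

open scoped Matrix.Norms.Frobenius

attribute [local instance] frobeniusInnerProductSpace

variable {m : Type*} [Fintype m] [DecidableEq m]
variable {E : Type*} [NormedAddCommGroup E] [InnerProductSpace ℝ E] [FiniteDimensional ℝ E]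
  [MeasurableSpace E] [BorelSpace E]
variable {ι : Type*} [Fintype ι] [LinearOrder ι]

omit [MeasurableSpace E] [BorelSpace E] in
/-- **Pointwise flux bound**: `|∑ᵢ (∑ⱼ ⟨F_{ij}, (div F)_j⟩) ∂ᵢφ| ≤ √2 ‖Dφ‖ √e √(∑ⱼ‖(div F)_j‖²)`
("applying Hölder's inequality on the last term" of (3.3)). [cite: Waldron2019, proof of Lemma 3.2] -/
theorem abs_flux_le (b : OrthonormalBasis ι ℝ E)
    (A : Connection E (Matrix m m ℂ)) (φ : E → ℝ) (y : E) :
    |∑ i, (∑ j, ⟪curvature A y (b i) (b j), divCurvature A y (b j)⟫) * fderiv ℝ φ y (b i)| ≤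
      Real.sqrt 2 * ‖fderiv ℝ φ y‖ * Real.sqrt (ymDensityOfBasis b A y) *
        Real.sqrt (∑ j, ‖divCurvature A y (b j)‖ ^ 2) := by
  have h := abs_sum_sum_inner_mul_le (fun i j => curvature A y (b i) (b j))
    (fun j => divCurvature A y (b j)) (fun i => fderiv ℝ φ y (b i))
  have ha : Real.sqrt (∑ i, (fderiv ℝ φ y (b i)) ^ 2) = ‖fderiv ℝ φ y‖ := by
    rw [sum_sq_apply_orthonormalBasis_eq b, Real.sqrt_sq (norm_nonneg _)]
  have hF : Real.sqrt (∑ i, ∑ j, ‖curvature A y (b i) (b j)‖ ^ 2) =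
      Real.sqrt 2 * Real.sqrt (ymDensityOfBasis b A y) := by
    rw [← Real.sqrt_mul (by norm_num : (0 : ℝ) ≤ 2), ymDensityOfBasis_eq_half_sum b A y]
    congr 1
    ring
  rw [ha, hF] at h
  calc _ ≤ _ := h
    _ = _ := by ring

omit [DecidableEq m] [Fintype m] [FiniteDimensional ℝ E] [MeasurableSpace E] [BorelSpace E] in
/-- A nonnegative `C¹` function vanishing at a point has vanishing derivative there (the point
is a minimum). [folklore] -/
theorem fderiv_eq_zero_of_nonneg_of_eq_zero {φ : E → ℝ} (hφ0 : ∀ y, 0 ≤ φ y) {y : E}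
    (hy : φ y = 0) : fderiv ℝ φ y = 0 := by
  have hmin : IsLocalMin φ y := Filter.Eventually.of_forall fun z => by rw [hy]; exact hφ0 z
  exact hmin.fderiv_eq_zero

/-- **Local energy comparison** (the heart of Waldron's Lemmas 3.2(a), 3.3(a)). Let `A` be a
jointly smooth `𝔲(m)`-valued solution of the Yang–Mills heat equation on the open time set
`𝒯 ⊇ [t₀, τ]`, `V` a bounded measurable set, `φ ∈ C¹_c`, `0 ≤ φ ≤ 1`, `φ = 0` off `V`,
`‖Dφ‖ ≤ K`. If `∫_V |F(s)|² ≤ E` for `s ∈ [t₀, τ]` and `∫_{t₀}^τ∫_V |D^*F|² ≤ δ²`, then for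
`t ∈ [t₀, τ]`, `|∫ φ|F(τ)|² − ∫ φ|F(t)|²| ≤ 2δ(δ + √2 K √((τ − t₀)E))`: integrate (3.3) from `t` to
`τ`; the dissipation term is at most `2δ²` and the flux term is bounded by Hölder,
`2∫∫|∑ᵢWᵢ∂ᵢφ| ≤ 2√2 K ∫_t^τ∫_V |F||D^*F| ≤ 2√2 K √((τ−t)E) δ`.
[cite: Waldron2019, Lemma 3.2 (a), proof] -/
theorem abs_weightedEnergy_sub_le_of_flow_on (b : OrthonormalBasis ι ℝ E)
    {A : ℝ → Connection E (Matrix m m ℂ)} {𝒯 : Set ℝ} (h𝒯 : IsOpen 𝒯)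
    (hA : ContDiffOn ℝ ∞ (fun p : ℝ × E => A p.1 p.2) (𝒯 ×ˢ (univ : Set E)))
    (hval : ∀ ⦃s : ℝ⦄, s ∈ 𝒯 → (A s).IsValuedIn (skewAdjoint.submodule ℝ (Matrix m m ℂ)))
    (hpde : ∀ ⦃s : ℝ⦄, s ∈ 𝒯 → ∀ y w, deriv (fun s' => A s' y w) s = divCurvature (A s) y w)
    {φ : E → ℝ} (hφ : ContDiff ℝ 1 φ) (hφc : HasCompactSupport φ)
    (hφ01 : ∀ y, 0 ≤ φ y ∧ φ y ≤ 1) {V : Set E} (hVm : MeasurableSet V)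
    (hVb : Bornology.IsBounded V) (hφV : ∀ y ∉ V, φ y = 0) {K : ℝ} (hK0 : 0 ≤ K)
    (hK : ∀ y, ‖fderiv ℝ φ y‖ ≤ K) {t₀ τ : ℝ} (hsub : Icc t₀ τ ⊆ 𝒯)
    {En δ : ℝ} (hEn0 : 0 ≤ En)
    (hEn : ∀ s ∈ Icc t₀ τ, ∫ y in V, ymDensityOfBasis b (A s) y ≤ En) (hδ0 : 0 ≤ δ)
    (hδ : ∫ s in t₀..τ, ∫ y in V, ∑ j, ‖divCurvature (A s) y (b j)‖ ^ 2 ≤ δ ^ 2)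
    {t : ℝ} (ht : t ∈ Icc t₀ τ) :
    |(∫ y, φ y * ymDensityOfBasis b (A τ) y) - ∫ y, φ y * ymDensityOfBasis b (A t) y| ≤
      2 * δ * (δ + Real.sqrt 2 * K * Real.sqrt ((τ - t₀) * En)) := by
  -- notation and basic facts
  have hsub' : Icc t τ ⊆ 𝒯 := fun s hs => hsub ⟨ht.1.trans hs.1, hs.2⟩
  have hsub0 : Icc t₀ t ⊆ 𝒯 := fun s hs => hsub ⟨hs.1, hs.2.trans ht.2⟩
  set Kc : Set E := closure V with hKc'
  have hKc : IsCompact Kc := hVb.isCompact_closure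
  have hVK : V ⊆ Kc := subset_closure
  set e : ℝ × E → ℝ := fun p => ymDensityOfBasis b (A p.1) p.2 with he
  set Dis : ℝ × E → ℝ := fun p => ∑ j, ‖divCurvature (A p.1) p.2 (b j)‖ ^ 2 with hDis
  set Fl : ℝ × E → ℝ := fun p => ∑ i, (∑ j, ⟪curvature (A p.1) p.2 (b i) (b j),
    divCurvature (A p.1) p.2 (b j)⟫) * fderiv ℝ φ p.2 (b i) with hFl
  have he_c : ContinuousOn e (𝒯 ×ˢ univ) :=
    (contDiffOn_ymDensityOfBasis_joint_on b h𝒯 hA ENat.LEInfty.out).continuousOn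
  have hDis_c : ContinuousOn Dis (𝒯 ×ˢ univ) := continuousOn_dissipation_of_flow_on b h𝒯 hA hpde
  have he0 : ∀ p, 0 ≤ e p := fun p => ymDensityOfBasis_nonneg b _ _
  have hDis0 : ∀ p, 0 ≤ Dis p := fun p => Finset.sum_nonneg fun j _ => by positivity
  have hφ0 : ∀ y, 0 ≤ φ y := fun y => (hφ01 y).1
  have hφ1 : ∀ y, φ y ≤ 1 := fun y => (hφ01 y).2
  have hφ_c : Continuous φ := hφ.continuous
  have hdφV : ∀ y ∉ V, fderiv ℝ φ y = 0 := fun y hy =>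
    fderiv_eq_zero_of_nonneg_of_eq_zero hφ0 (hφV y hy)
  have hInt : ∀ {f : E → ℝ}, Continuous f → IntegrableOn f V := fun hf =>
    (hf.continuousOn.integrableOn_compact hKc).mono_set hVK
  -- the identity (3.3) on `[t, τ]`
  have hid := weightedEnergy_sub_eq_flux_of_flow_on b h𝒯 hA hval hpde hφ hφc ht.2 hsub'
  -- (1) the weighted dissipation: `0 ≤ ∫_t^τ∫ φ Dis ≤ δ²`
  have hDφ_le : ∀ s ∈ Icc t τ, ∫ y, φ y * Dis (s, y) ≤ ∫ y in V, Dis (s, y) := by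
    intro s hs
    have hDs : Continuous fun y => Dis (s, y) := continuous_slice_of_continuousOn_slab hDis_c (hsub' hs)
    have hzero : ∀ y ∉ V, φ y * Dis (s, y) = 0 := fun y hy => by rw [hφV y hy, zero_mul]
    rw [← setIntegral_eq_integral_of_forall_compl_eq_zero hzero]
    refine setIntegral_mono_on (hInt (hφ_c.mul hDs)) (hInt hDs) hVm fun y _ => ?_
    calc φ y * Dis (s, y) ≤ 1 * Dis (s, y) := mul_le_mul_of_nonneg_right (hφ1 y) (hDis0 _)
      _ = Dis (s, y) := one_mul _
  have hDφ_nn : ∀ s, 0 ≤ ∫ y, φ y * Dis (s, y) := fun s =>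
    integral_nonneg fun y => mul_nonneg (hφ0 y) (hDis0 _)
  have hDisV_t : ∀ {a c : ℝ}, a ≤ c → Icc a c ⊆ 𝒯 →
      IntervalIntegrable (fun s => ∫ y in V, Dis (s, y)) volume a c := fun hac hI =>
    intervalIntegrable_setIntegral_of_continuousOn hKc hVK hDis_c hac hI
  have hDisV_nn : ∀ {a c : ℝ}, a ≤ c → 0 ≤ ∫ s in a..c, ∫ y in V, Dis (s, y) := fun hac =>
    intervalIntegral.integral_nonneg hac fun s _ => setIntegral_nonneg hVm fun y _ => hDis0 _
  have hDisV_tτ : ∫ s in t..τ, ∫ y in V, Dis (s, y) ≤ δ ^ 2 := by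
    have hadd := intervalIntegral.integral_add_adjacent_intervals (hDisV_t ht.1 hsub0)
      (hDisV_t ht.2 hsub')
    have h0 := hDisV_nn ht.1
    linarith
  have hφDis_c : ContinuousOn (fun p : ℝ × E => φ p.2 * Dis p) (𝒯 ×ˢ univ) :=
    (hφ_c.comp_continuousOn continuousOn_snd).mul hDis_c
  have hDφ_t : IntervalIntegrable (fun s => ∫ y, φ y * Dis (s, y)) volume t τ :=
    intervalIntegrable_integral_of_continuousOn (g := fun p => φ p.2 * Dis p) hφc hφDis_c
      (fun s y hy => by simp only [image_eq_zero_of_notMem_tsupport hy, zero_mul]) ht.2 hsub'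
  have hDφ_upper : ∫ s in t..τ, ∫ y, φ y * Dis (s, y) ≤ δ ^ 2 :=
    (intervalIntegral.integral_mono_on ht.2 hDφ_t (hDisV_t ht.2 hsub') hDφ_le).trans hDisV_tτ
  have hDφ_lower : 0 ≤ ∫ s in t..τ, ∫ y, φ y * Dis (s, y) :=
    intervalIntegral.integral_nonneg ht.2 fun s _ => hDφ_nn s
  -- (2) the flux: `|∫_t^τ∫ Fl| ≤ √2 K √((τ - t₀) E) δ`
  have hsq_c : ContinuousOn (fun p : ℝ × E => Real.sqrt (e p) * Real.sqrt (Dis p)) (𝒯 ×ˢ univ) :=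
    (Real.continuous_sqrt.comp_continuousOn he_c).mul (Real.continuous_sqrt.comp_continuousOn hDis_c)
  have hFl_pt : ∀ s y, |Fl (s, y)| ≤
      Real.sqrt 2 * K * V.indicator (fun y => Real.sqrt (e (s, y)) * Real.sqrt (Dis (s, y))) y := by
    intro s y
    by_cases hy : y ∈ V
    · rw [indicator_of_mem hy]
      calc |Fl (s, y)| ≤ Real.sqrt 2 * ‖fderiv ℝ φ y‖ * Real.sqrt (e (s, y)) *
            Real.sqrt (Dis (s, y)) := abs_flux_le b (A s) φ y
        _ ≤ Real.sqrt 2 * K * Real.sqrt (e (s, y)) * Real.sqrt (Dis (s, y)) := by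
            gcongr
            exact hK y
        _ = _ := by ring
    · rw [indicator_of_notMem hy, mul_zero]
      refine le_of_eq (abs_eq_zero.mpr ?_)
      simp only [hFl]
      refine Finset.sum_eq_zero fun i _ => ?_
      rw [hdφV y hy, zero_apply, mul_zero]
  have hFl_s : ∀ s ∈ Icc t τ, |∫ y, Fl (s, y)| ≤
      Real.sqrt 2 * K * ∫ y in V, Real.sqrt (e (s, y)) * Real.sqrt (Dis (s, y)) := by
    intro s hs
    have hs𝒯 : s ∈ 𝒯 := hsub' hs
    have hcs : Continuous fun y => Real.sqrt (e (s, y)) * Real.sqrt (Dis (s, y)) :=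
      continuous_slice_of_continuousOn_slab hsq_c hs𝒯
    have hint : Integrable fun y => Real.sqrt 2 * K *
        V.indicator (fun y => Real.sqrt (e (s, y)) * Real.sqrt (Dis (s, y))) y := by
      refine Integrable.const_mul ?_ _
      rw [integrable_indicator_iff hVm]
      exact hInt hcs
    have h := norm_integral_le_of_norm_le hint (ae_of_all _ fun y => by
      rw [Real.norm_eq_abs]; exact hFl_pt s y)
    rw [Real.norm_eq_abs, integral_const_mul, integral_indicator hVm] at h
    exact h
  have hsq_t : IntervalIntegrable
      (fun s => Real.sqrt 2 * K * ∫ y in V, Real.sqrt (e (s, y)) * Real.sqrt (Dis (s, y)))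
      volume t τ :=
    (intervalIntegrable_setIntegral_of_continuousOn hKc hVK hsq_c ht.2 hsub').const_mul _
  have hFl_bound : |∫ s in t..τ, ∫ y, Fl (s, y)| ≤
      Real.sqrt 2 * K * Real.sqrt ((τ - t₀) * En) * δ := by
    have h1 := intervalIntegral.norm_integral_le_of_norm_le (f := fun s => ∫ y, Fl (s, y))
      (μ := volume) ht.2 (ae_of_all _ fun s hs => by
        rw [Real.norm_eq_abs]; exact hFl_s s ⟨hs.1.le, hs.2⟩) hsq_t
    rw [Real.norm_eq_abs, intervalIntegral.integral_const_mul] at h1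
    -- Cauchy–Schwarz in space-time
    have hCS := intervalIntegral_setIntegral_sqrt_mul_sqrt_le hKc hVK hVm he_c hDis_c he0 hDis0
      ht.2 hsub'
    -- the energy integral is at most `(τ - t₀) E`
    have heV_t : IntervalIntegrable (fun s => ∫ y in V, e (s, y)) volume t τ :=
      intervalIntegrable_setIntegral_of_continuousOn hKc hVK he_c ht.2 hsub'
    have heV : ∫ s in t..τ, ∫ y in V, e (s, y) ≤ (τ - t₀) * En := by
      calc ∫ s in t..τ, ∫ y in V, e (s, y) ≤ ∫ s in t..τ, En :=
            intervalIntegral.integral_mono_on ht.2 heV_t intervalIntegrable_const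
              fun s hs => hEn s ⟨ht.1.trans hs.1, hs.2⟩
        _ = (τ - t) * En := by rw [intervalIntegral.integral_const, smul_eq_mul]
        _ ≤ (τ - t₀) * En := mul_le_mul_of_nonneg_right (by linarith [ht.1]) hEn0
    have hsqE : Real.sqrt (∫ s in t..τ, ∫ y in V, e (s, y)) ≤ Real.sqrt ((τ - t₀) * En) :=
      Real.sqrt_le_sqrt heV
    have hsqD : Real.sqrt (∫ s in t..τ, ∫ y in V, Dis (s, y)) ≤ δ := by
      rw [← Real.sqrt_sq hδ0]
      exact Real.sqrt_le_sqrt hDisV_tτ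
    calc |∫ s in t..τ, ∫ y, Fl (s, y)|
        ≤ Real.sqrt 2 * K * ∫ s in t..τ, ∫ y in V, Real.sqrt (e (s, y)) * Real.sqrt (Dis (s, y)) := h1
      _ ≤ Real.sqrt 2 * K * (Real.sqrt ((τ - t₀) * En) * δ) := by
          refine mul_le_mul_of_nonneg_left (hCS.trans ?_) (by positivity)
          exact mul_le_mul hsqE hsqD (Real.sqrt_nonneg _) (Real.sqrt_nonneg _)
      _ = Real.sqrt 2 * K * Real.sqrt ((τ - t₀) * En) * δ := by ring
  -- (3) combine
  rw [hid]
  have habs : |(-2) * (∫ s in t..τ, ∫ y, φ y * Dis (s, y)) - 2 * ∫ s in t..τ, ∫ y, Fl (s, y)| ≤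
      2 * (∫ s in t..τ, ∫ y, φ y * Dis (s, y)) + 2 * |∫ s in t..τ, ∫ y, Fl (s, y)| := by
    refine (abs_sub _ _).trans ?_
    rw [abs_mul, abs_mul, abs_neg, abs_two, abs_of_nonneg hDφ_lower]
  refine habs.trans ?_
  nlinarith [hFl_bound, hDφ_upper, hδ0, hK0, Real.sqrt_nonneg ((τ - t₀) * En), Real.sqrt_nonneg 2]

omit [DecidableEq m] [Fintype m] [LinearOrder ι] [Fintype ι] in
/-- From the weighted comparison to set integrals: if `0 ≤ φ ≤ 1`, `φ = 1` on the measurable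
`V₁`, `φ = 0` off the bounded measurable `V₂`, and `∫ φ e₁ − ∫ φ e₂ ≤ γ` for nonnegative
continuous `e₁, e₂`, then `∫_{V₁} e₁ ≤ ∫_{V₂} e₂ + γ`. [folklore] -/
theorem setIntegral_le_setIntegral_add_of_weighted_sub_le {φ e₁ e₂ : E → ℝ}
    (hφc : Continuous φ) (hφcs : HasCompactSupport φ) (hφ01 : ∀ y, 0 ≤ φ y ∧ φ y ≤ 1)
    {V₁ V₂ : Set E} (hV₁m : MeasurableSet V₁) (hV₂m : MeasurableSet V₂)
    (hV₂b : Bornology.IsBounded V₂) (hφ1 : ∀ y ∈ V₁, φ y = 1) (hφV : ∀ y ∉ V₂, φ y = 0)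
    (he₁ : Continuous e₁) (he₂ : Continuous e₂) (he₁0 : ∀ y, 0 ≤ e₁ y) (he₂0 : ∀ y, 0 ≤ e₂ y)
    {γ : ℝ} (h : (∫ y, φ y * e₁ y) - ∫ y, φ y * e₂ y ≤ γ) :
    ∫ y in V₁, e₁ y ≤ (∫ y in V₂, e₂ y) + γ := by
  have hKc : IsCompact (closure V₂) := hV₂b.isCompact_closure
  have hφ0 : ∀ y, 0 ≤ φ y := fun y => (hφ01 y).1
  have hφle : ∀ y, φ y ≤ 1 := fun y => (hφ01 y).2
  have h1 : ∫ y in V₁, e₁ y ≤ ∫ y, φ y * e₁ y := by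
    have hfi : Integrable fun y => φ y * e₁ y :=
      (hφc.mul he₁).integrable_of_hasCompactSupport hφcs.mul_right
    have hnn : ∀ y, 0 ≤ φ y * e₁ y := fun y => mul_nonneg (hφ0 y) (he₁0 y)
    calc ∫ y in V₁, e₁ y = ∫ y in V₁, φ y * e₁ y :=
          setIntegral_congr_fun hV₁m fun y hy => by rw [hφ1 y hy, one_mul]
      _ ≤ ∫ y, φ y * e₁ y := setIntegral_le_integral hfi (ae_of_all _ hnn)
  have h2 : ∫ y, φ y * e₂ y ≤ ∫ y in V₂, e₂ y := by
    have hzero : ∀ y ∉ V₂, φ y * e₂ y = 0 := fun y hy => by rw [hφV y hy, zero_mul]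
    rw [← setIntegral_eq_integral_of_forall_compl_eq_zero hzero]
    refine setIntegral_mono_on
      (((hφc.mul he₂).continuousOn.integrableOn_compact hKc).mono_set subset_closure)
      ((he₂.continuousOn.integrableOn_compact hKc).mono_set subset_closure) hV₂m fun y _ => ?_
    calc φ y * e₂ y ≤ 1 * e₂ y := mul_le_mul_of_nonneg_right (hφle y) (he₂0 y)
      _ = e₂ y := one_mul _
  linarith

/-- **Waldron's Lemma 3.2 (a)** (flat setting; `|F|² = ∑_{i<j}‖F_{ij}‖²`, `|D^*F|² = ∑ⱼ‖(div F)_j‖²`,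
`B_ρ = B_ρ(x₀)`). There is an absolute constant `c` (from the cut-off for `B_{R/2} ⊂ B_R`;
Waldron's gradient bound `4/R` gives his `c = 4`) such that: if `A` is a jointly smooth
`𝔲(m)`-valued solution of the Yang–Mills heat equation on the open time set `𝒯 ⊇ [t₀, τ]`,
`sup_{t₀ ≤ t ≤ τ} ‖F(t)‖²_{L²(B_R)} ≤ E` and `‖D^*F‖²_{L²(B_R × [t₀,τ])} ≤ δ²`, then with
`γ = 2δ(δ + c√((τ − t₀)E)/R)`, for all `t₀ ≤ t ≤ τ`,
`‖F(τ)‖²_{L²(B_{R/2})} ≤ ‖F(t)‖²_{L²(B_R)} + γ` and `‖F(t)‖²_{L²(B_{R/2})} ≤ ‖F(τ)‖²_{L²(B_R)} + γ`.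
[cite: Waldron2019, Lemma 3.2 (a)] -/
theorem Waldron2019_lemma_3_2a (b : OrthonormalBasis ι ℝ E) :
    ∃ c : ℝ, 0 ≤ c ∧ ∀ {A : ℝ → Connection E (Matrix m m ℂ)} {𝒯 : Set ℝ}, IsOpen 𝒯 →
      ContDiffOn ℝ ∞ (fun p : ℝ × E => A p.1 p.2) (𝒯 ×ˢ (univ : Set E)) →
      (∀ ⦃s : ℝ⦄, s ∈ 𝒯 → (A s).IsValuedIn (skewAdjoint.submodule ℝ (Matrix m m ℂ))) →
      (∀ ⦃s : ℝ⦄, s ∈ 𝒯 → ∀ y w, deriv (fun s' => A s' y w) s = divCurvature (A s) y w) →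
      ∀ (x₀ : E) {R : ℝ}, 0 < R → ∀ {t₀ τ : ℝ}, Icc t₀ τ ⊆ 𝒯 → ∀ {En δ : ℝ}, 0 ≤ En →
      (∀ s ∈ Icc t₀ τ, ∫ y in ball x₀ R, ymDensityOfBasis b (A s) y ≤ En) → 0 ≤ δ →
      (∫ s in t₀..τ, ∫ y in ball x₀ R, ∑ j, ‖divCurvature (A s) y (b j)‖ ^ 2 ≤ δ ^ 2) →
      ∀ t ∈ Icc t₀ τ,
        (∫ y in ball x₀ (R / 2), ymDensityOfBasis b (A τ) y ≤
          (∫ y in ball x₀ R, ymDensityOfBasis b (A t) y) +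
            2 * δ * (δ + c * Real.sqrt ((τ - t₀) * En) / R)) ∧
        (∫ y in ball x₀ (R / 2), ymDensityOfBasis b (A t) y ≤
          (∫ y in ball x₀ R, ymDensityOfBasis b (A τ) y) +
            2 * δ * (δ + c * Real.sqrt ((τ - t₀) * En) / R)) := by
  obtain ⟨M, hM0, hrad⟩ := Literature.Analysis.Calculus.exists_radial_cutoff_gradient_le (E := E)
  refine ⟨2 * Real.sqrt 2 * M, by positivity, ?_⟩
  intro A 𝒯 h𝒯 hA hval hpde x₀ R hR t₀ τ hsub En δ hEn0 hEn hδ0 hδ t ht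
  obtain ⟨φ, hφs, hφ0, hφ1, hone, hzero, hφcs, hgrad⟩ := hrad x₀ (R / 2) R (by positivity)
    (by linarith)
  have hφC1 : ContDiff ℝ 1 φ := hφs.of_le ENat.LEInfty.out
  have hφ01 : ∀ y, 0 ≤ φ y ∧ φ y ≤ 1 := fun y => ⟨hφ0 y, hφ1 y⟩
  have hφV : ∀ y ∉ ball x₀ R, φ y = 0 := fun y hy => hzero y (not_lt.mp (mt mem_ball.mpr hy))
  have hK : ∀ y, ‖fderiv ℝ φ y‖ ≤ 2 * M / R := fun y => by
    have h := hgrad y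
    rwa [show R - R / 2 = R / 2 by ring, div_div_eq_mul_div, mul_comm M 2] at h
  have hcomp := abs_weightedEnergy_sub_le_of_flow_on b h𝒯 hA hval hpde hφC1 hφcs hφ01
    measurableSet_ball isBounded_ball hφV (by positivity) hK hsub hEn0 hEn hδ0 hδ ht
  have hγ : 2 * δ * (δ + Real.sqrt 2 * (2 * M / R) * Real.sqrt ((τ - t₀) * En)) =
      2 * δ * (δ + 2 * Real.sqrt 2 * M * Real.sqrt ((τ - t₀) * En) / R) := by
    field_simp
  rw [hγ] at hcomp
  have hτ : τ ∈ 𝒯 := hsub ⟨ht.1.trans ht.2, le_rfl⟩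
  have ht𝒯 : t ∈ 𝒯 := hsub ht
  have he_c : ContinuousOn (fun p : ℝ × E => ymDensityOfBasis b (A p.1) p.2) (𝒯 ×ˢ univ) :=
    (contDiffOn_ymDensityOfBasis_joint_on b h𝒯 hA ENat.LEInfty.out).continuousOn
  have heτ : Continuous fun y => ymDensityOfBasis b (A τ) y :=
    continuous_slice_of_continuousOn_slab he_c hτ
  have het : Continuous fun y => ymDensityOfBasis b (A t) y :=
    continuous_slice_of_continuousOn_slab he_c ht𝒯
  have hone' : ∀ y ∈ ball x₀ (R / 2), φ y = 1 := fun y hy => hone y (mem_ball.mp hy).le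
  constructor
  · exact setIntegral_le_setIntegral_add_of_weighted_sub_le hφs.continuous hφcs hφ01
      measurableSet_ball measurableSet_ball isBounded_ball hone' hφV heτ het
      (fun y => ymDensityOfBasis_nonneg b _ y) (fun y => ymDensityOfBasis_nonneg b _ y)
      (le_abs_self _ |>.trans hcomp)
  · exact setIntegral_le_setIntegral_add_of_weighted_sub_le hφs.continuous hφcs hφ01
      measurableSet_ball measurableSet_ball isBounded_ball hone' hφV het heτ
      (fun y => ymDensityOfBasis_nonneg b _ y) (fun y => ymDensityOfBasis_nonneg b _ y)
      (by rw [abs_sub_comm] at hcomp; exact le_abs_self _ |>.trans hcomp)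

/-- **Waldron's Lemma 3.3 (a)** (flat setting). There is an absolute constant `c` (from the
cut-off for `U₁ ⋐ U₂`; Waldron: "replace `γ` by `10γ/(1−α)`") such that: for `½ ≤ α < 1`,
`U₁ = U_{αR}^R = B̄_R ∖ B_{αR}`, `U₂ = U_{α²R}^{R/α} = B̄_{R/α} ∖ B_{α²R}`, if `A` is a jointly
smooth `𝔲(m)`-valued solution of the Yang–Mills heat equation on the open time set
`𝒯 ⊇ [t₀, τ]`, `sup_{t₀ ≤ t ≤ τ} ‖F(t)‖²_{L²(U₂)} ≤ E` and `‖D^*F‖²_{L²(U₂ × [t₀,τ])} ≤ δ²`, then with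
`γ = 2δ(δ + c√((τ − t₀)E)/((1 − α)R))`, for all `t₀ ≤ t ≤ τ`,
`‖F(τ)‖²_{L²(U₁)} ≤ ‖F(t)‖²_{L²(U₂)} + γ` and `‖F(t)‖²_{L²(U₁)} ≤ ‖F(τ)‖²_{L²(U₂)} + γ`.
[cite: Waldron2019, Lemma 3.3 (a)] -/
theorem Waldron2019_lemma_3_3a (b : OrthonormalBasis ι ℝ E) :
    ∃ c : ℝ, 0 ≤ c ∧ ∀ {A : ℝ → Connection E (Matrix m m ℂ)} {𝒯 : Set ℝ}, IsOpen 𝒯 →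
      ContDiffOn ℝ ∞ (fun p : ℝ × E => A p.1 p.2) (𝒯 ×ˢ (univ : Set E)) →
      (∀ ⦃s : ℝ⦄, s ∈ 𝒯 → (A s).IsValuedIn (skewAdjoint.submodule ℝ (Matrix m m ℂ))) →
      (∀ ⦃s : ℝ⦄, s ∈ 𝒯 → ∀ y w, deriv (fun s' => A s' y w) s = divCurvature (A s) y w) →
      ∀ (x₀ : E) {R α : ℝ}, 0 < R → 1 / 2 ≤ α → α < 1 → ∀ {t₀ τ : ℝ}, Icc t₀ τ ⊆ 𝒯 →
      ∀ {En δ : ℝ}, 0 ≤ En →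
      (∀ s ∈ Icc t₀ τ, ∫ y in closedBall x₀ (R / α) \ ball x₀ (α ^ 2 * R),
        ymDensityOfBasis b (A s) y ≤ En) → 0 ≤ δ →
      (∫ s in t₀..τ, ∫ y in closedBall x₀ (R / α) \ ball x₀ (α ^ 2 * R),
        ∑ j, ‖divCurvature (A s) y (b j)‖ ^ 2 ≤ δ ^ 2) →
      ∀ t ∈ Icc t₀ τ,
        (∫ y in closedBall x₀ R \ ball x₀ (α * R), ymDensityOfBasis b (A τ) y ≤
          (∫ y in closedBall x₀ (R / α) \ ball x₀ (α ^ 2 * R), ymDensityOfBasis b (A t) y) +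
            2 * δ * (δ + c * Real.sqrt ((τ - t₀) * En) / ((1 - α) * R))) ∧
        (∫ y in closedBall x₀ R \ ball x₀ (α * R), ymDensityOfBasis b (A t) y ≤
          (∫ y in closedBall x₀ (R / α) \ ball x₀ (α ^ 2 * R), ymDensityOfBasis b (A τ) y) +
            2 * δ * (δ + c * Real.sqrt ((τ - t₀) * En) / ((1 - α) * R))) := by
  obtain ⟨M, hM0, hann⟩ := Literature.Analysis.Calculus.exists_annular_cutoff_gradient_le (E := E)
  refine ⟨3 * Real.sqrt 2 * M, by positivity, ?_⟩
  intro A 𝒯 h𝒯 hA hval hpde x₀ R α hR hα hα1 t₀ τ hsub En δ hEn0 hEn hδ0 hδ t ht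
  have hα0 : 0 < α := by linarith
  have h1α : 0 < 1 - α := by linarith
  -- the annular cut-off for `U₁ ⊂ U₂`
  have hr1 : α ^ 2 * R < α * R := by
    calc α ^ 2 * R = α * (α * R) := by ring
      _ < 1 * (α * R) := mul_lt_mul_of_pos_right hα1 (by positivity)
      _ = α * R := one_mul _
  have hr2 : α * R ≤ R := mul_le_of_le_one_left hR.le hα1.le
  have hr3 : R < R / α := by
    rw [lt_div_iff₀ hα0]
    exact mul_lt_of_lt_one_right hR hα1
  obtain ⟨φ, hφs, hφ0, hφ1, hone, hzin, hzout, hφcs, hgrad⟩ := hann x₀ (α ^ 2 * R) (α * R) R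
    (R / α) (by positivity) hr1 hr2 hr3
  have hφC1 : ContDiff ℝ 1 φ := hφs.of_le ENat.LEInfty.out
  have hφ01 : ∀ y, 0 ≤ φ y ∧ φ y ≤ 1 := fun y => ⟨hφ0 y, hφ1 y⟩
  set U₂ : Set E := closedBall x₀ (R / α) \ ball x₀ (α ^ 2 * R) with hU₂
  have hU₂m : MeasurableSet U₂ := measurableSet_closedBall.diff measurableSet_ball
  have hU₂b : Bornology.IsBounded U₂ := isBounded_closedBall.subset fun _ hy => hy.1
  have hφV : ∀ y ∉ U₂, φ y = 0 := by
    intro y hy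
    by_cases h1 : dist y x₀ ≤ R / α
    · have h2 : dist y x₀ < α ^ 2 * R := by
        by_contra h2
        exact hy ⟨mem_closedBall.mpr h1, fun hb => h2 (mem_ball.mp hb)⟩
      exact hzin y h2.le
    · exact hzout y (le_of_lt (not_le.mp h1))
  -- the gradient bound `‖Dφ‖ ≤ 3M/((1-α)R)`
  have hKval : M / (α * R - α ^ 2 * R) + M / (R / α - R) ≤ 3 * M / ((1 - α) * R) := by
    have hb : 0 < (1 - α) * R := by positivity
    have h1 : M / (α * R - α ^ 2 * R) ≤ 2 * M / ((1 - α) * R) := by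
      have hle : (1 - α) * R / 2 ≤ α * R - α ^ 2 * R := by nlinarith
      calc M / (α * R - α ^ 2 * R) ≤ M / ((1 - α) * R / 2) :=
            div_le_div_of_nonneg_left hM0 (by positivity) hle
        _ = 2 * M / ((1 - α) * R) := by rw [div_div_eq_mul_div]; ring
    have h2 : M / (R / α - R) ≤ M / ((1 - α) * R) := by
      have hle : (1 - α) * R ≤ R / α - R := by
        rw [le_sub_iff_add_le, le_div_iff₀ hα0]
        nlinarith [sq_nonneg (α - 1)]
      exact div_le_div_of_nonneg_left hM0 hb hle
    calc M / (α * R - α ^ 2 * R) + M / (R / α - R) ≤ 2 * M / ((1 - α) * R) + M / ((1 - α) * R) :=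
          add_le_add h1 h2
      _ = 3 * M / ((1 - α) * R) := by ring
  have hK : ∀ y, ‖fderiv ℝ φ y‖ ≤ 3 * M / ((1 - α) * R) := fun y => (hgrad y).trans hKval
  have hcomp := abs_weightedEnergy_sub_le_of_flow_on b h𝒯 hA hval hpde hφC1 hφcs hφ01 hU₂m hU₂b
    hφV (by positivity) hK hsub hEn0 hEn hδ0 hδ ht
  have hγ : 2 * δ * (δ + Real.sqrt 2 * (3 * M / ((1 - α) * R)) * Real.sqrt ((τ - t₀) * En)) =
      2 * δ * (δ + 3 * Real.sqrt 2 * M * Real.sqrt ((τ - t₀) * En) / ((1 - α) * R)) := by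
    field_simp
  rw [hγ] at hcomp
  have hτ : τ ∈ 𝒯 := hsub ⟨ht.1.trans ht.2, le_rfl⟩
  have ht𝒯 : t ∈ 𝒯 := hsub ht
  have he_c : ContinuousOn (fun p : ℝ × E => ymDensityOfBasis b (A p.1) p.2) (𝒯 ×ˢ univ) :=
    (contDiffOn_ymDensityOfBasis_joint_on b h𝒯 hA ENat.LEInfty.out).continuousOn
  have heτ : Continuous fun y => ymDensityOfBasis b (A τ) y :=
    continuous_slice_of_continuousOn_slab he_c hτ
  have het : Continuous fun y => ymDensityOfBasis b (A t) y :=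
    continuous_slice_of_continuousOn_slab he_c ht𝒯
  have hU₁m : MeasurableSet (closedBall x₀ R \ ball x₀ (α * R)) :=
    measurableSet_closedBall.diff measurableSet_ball
  have hone' : ∀ y ∈ closedBall x₀ R \ ball x₀ (α * R), φ y = 1 := fun y hy =>
    hone y (not_lt.mp (mt mem_ball.mpr hy.2)) (mem_closedBall.mp hy.1)
  constructor
  · exact setIntegral_le_setIntegral_add_of_weighted_sub_le hφs.continuous hφcs hφ01
      hU₁m hU₂m hU₂b hone' hφV heτ het
      (fun y => ymDensityOfBasis_nonneg b _ y) (fun y => ymDensityOfBasis_nonneg b _ y)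
      (le_abs_self _ |>.trans hcomp)
  · exact setIntegral_le_setIntegral_add_of_weighted_sub_le hφs.continuous hφcs hφ01
      hU₁m hU₂m hU₂b hone' hφV het heτ
      (fun y => ymDensityOfBasis_nonneg b _ y) (fun y => ymDensityOfBasis_nonneg b _ y)
      (by rw [abs_sub_comm] at hcomp; exact le_abs_self _ |>.trans hcomp)

end LocalComparison

end Literature.MathematicalPhysics.QuantumLattice
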